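import Summits.QuantumFields.BalabanUV.Beta.FP.BlockAveragedKernelDipole
import Literature.MathematicalPhysics.QuantumFieldTheory.Balaban1983to89.Beta.AxialBlockWeights
import Literature.MathematicalPhysics.QuantumFieldTheory.Balaban1983to89.Beta.AffineAveraging

/-!
# Road FP (binder row D1), row H′2-IR ∕ IR-1-ABS — PART 4: THE INSTANCE AT THE PLAIN (SCALAR) BLOCK SUM `AffineAveraging.blockSum`
# — the `Q′`-side letters for the ghost remainder (IR-4's `G₀Q′ᵀ`, `Q′G₀Q′ᵀ` shapes): VALUE PROFILE, DIFFERENCES, DOUBLE SUM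
# (our bookkeeping; no estimate of any propagator)

HONEST DEPENDENCY (page 1, mandatory): continuum YM on T⁴ ⇐ BetaPertH ∧ nine spine estimates (0/9 proved); BetaPertH ⇐ (D1) ∧ (D4) ∧
CAP+tail; G-an2-4 gates asym, D1 and NE2/3/4.  HONEST FRAMING (cell contract, verbatim): «discharging `BetaPertH` makes Bałaban's UV
stability UNCONDITIONAL — a real constructive-QFT result; it is NOT the continuum limit and NOT the Clay problem.»  THIS MODULE is
elementary real analysis on finite sums over `ℤ⁴` (our bookkeeping): it cites nothing, mints no `def … : Prop`, declares no data `def`,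
has 0 `sorry`.  The block sum is an2's `AffineAveraging.blockSum n f u = Σ_{b ∈ {0,…,n−1}⁴} f(n•u + b)` (the scalar averaging `Q′`
WITHOUT its `n⁻⁴`, as used by `ScalarBlockKKT` ∕ `FP/ConstrainedGhost`), read BY NAME.  The kernel `P` is ARBITRARY with displayed
letters.  It discharges NOTHING of row H′2-IR, of `hasym`, of D1 or of `BetaPertH`; NOT (CONV-C), NOT D1, NOT the continuum limit, NOT Clay.

ABSOLUTE RULE (cell charter, verbatim): «No internally-minted statement may enter as a cited fact. Every hypothesis is either
kernel-proved in this package or a verbatim quotation of a PUBLISHED theorem with page reference. The manuscript(s) under audit are NOT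
citable for their own disputed steps — they are the thing under adjudication; programme-internal (2001/route/tribunal) claims are never
citable.»

MECHANISM: `n⁻⁴·blockSum n` is a block sum over `box 4 n` against the weight profile `n⁻⁴·𝟙_{fineBlock n}` (mass `1`, flatness `n⁻⁴`,
`n⁻⁴·(n+1)⁴ ≤ 16`), so PART 1's PROFILE ∕ difference profile and PART 2's double average apply with the amplitude
`3^a·(6561·16 + 1) = 3^a·104977`.

CONTENT.
* §1 `sum_affineBox_eq_sum_fineBlock` (re-indexing an2's `ℕ`-offset box by `toSite`), `fineBlock_subset_box`, **`blockAvg_eq_boxSum`**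
  (`n⁻⁴·blockSum n f u = Σ_{m ∈ box 4 n} w m·f(n•u + m)`, `w := n⁻⁴·𝟙_{fineBlock n}` written inline), the letters (mass ≤ 1, flatness ≤ n⁻⁴, volume ≤ 16).
* §2 (i′) **`abs_blockAvg_le_profile`** (`a ≤ 3`, `n ≥ 1`): `|n⁻⁴·blockSum n (y ↦ P(x − y)) u| ≤ 3^a·104977·C₀ ∕ (n + 1 + ‖x − n•u‖∞)^a`;
  (ii′) **`abs_blockAvg_fwdDiff_le_profile`** (degree `a+1 ≤ 3`, one power better); (ii″) `abs_blockAvg_fwdDiff₂_le_profile_marginal`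
  (second differences, degree 4: ONE log of the block scale, genuine at block edges); (iii′) `blockAvg₂_eq_doubleBoxSum`, **`abs_blockAvg₂_le_profile`**
  (`|n⁻⁸·blockSum n (y ↦ blockSum n (y′ ↦ P(y − y′)) v) u| ≤ (3^a·104977)²·C₀ ∕ (n+1+n‖u−v‖∞)^a`) and `abs_blockAvg₂_le_coarse`
  (`≤ (3^a·104977)²·C₀ ∕ (n^a·(1+‖u−v‖∞)^a)` — at `a = 2` the owner's `C₂ n⁻²(1 + |u − v|∞)⁻²` for the plain `n⁻⁸ΣΣ` double block average).
Unit `b2b-balaban-gan24-formalise-leaf-04` (gen 39, idle G-an2-4 swarm leaf seat, cross-lane), 2026-08-20; `LEAVES-FP.md` rows IR-1-ABS ∕ IR-1-GEN.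
-/

noncomputable section

namespace Summit.QuantumFields.BalabanUV.Beta.FP.BlockAveragedKernelScalar

open Finset
open scoped BigOperators
open Literature.Probability.LatticeModels (box mem_box zero_mem_box)
open Literature.MathematicalPhysics.QuantumFieldTheory.Balaban1983to89.Beta.DyadicShell
  (Pt supNorm supNorm_le_iff mem_box_iff supNorm_eq_zero_iff)
open Literature.MathematicalPhysics.QuantumFieldTheory.Balaban1983to89.Beta.BlockLegs (supNorm_nsmul_real)
open Literature.MathematicalPhysics.QuantumFieldTheory.Balaban1983to89.Beta.AxialBlockWeights (fineBlock mem_fineBlock card_fineBlock)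
open Literature.MathematicalPhysics.QuantumFieldTheory.Balaban1983to89.Beta.AffineAveraging (toSite blockSum)
open Summit.QuantumFields.BalabanUV.Beta.FP.BlockAveragedKernel
open Summit.QuantumFields.BalabanUV.Beta.FP.BlockAveragedKernelDipole

/-! ## §1 an2's block sum as a block sum over the sup-box against a flat weight -/

/-- [our bookkeeping] Re-indexing an2's `ℕ`-offset box by `toSite`: `Σ_{b ∈ {0..n−1}⁴ ⊂ ℕ⁴} g(toSite b) = Σ_{m ∈ fineBlock n ⊂ ℤ⁴} g m`. -/
theorem sum_affineBox_eq_sum_fineBlock (n : ℕ) (g : Pt → ℝ) :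
    ∑ b ∈ Literature.MathematicalPhysics.QuantumFieldTheory.Balaban1983to89.Beta.AffineAveraging.box 4 n, g (toSite b)
      = ∑ m ∈ fineBlock n, g m := by
  refine Finset.sum_nbij' (fun b => toSite b) (fun m => fun i => (m i).toNat) ?_ ?_ ?_ ?_ ?_
  · intro b hb
    simp only [Literature.MathematicalPhysics.QuantumFieldTheory.Balaban1983to89.Beta.AffineAveraging.box, Fintype.mem_piFinset,
      Finset.mem_range] at hb
    exact mem_fineBlock.mpr fun i => ⟨by simp [toSite], by simpa [toSite] using hb i⟩
  · intro m hm
    rw [mem_fineBlock] at hm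
    simp only [Literature.MathematicalPhysics.QuantumFieldTheory.Balaban1983to89.Beta.AffineAveraging.box, Fintype.mem_piFinset,
      Finset.mem_range]
    intro i
    have h := hm i
    omega
  · intro b _
    funext i
    simp [toSite]
  · intro m hm
    rw [mem_fineBlock] at hm
    funext i
    simp only [toSite, Int.toNat_of_nonneg (hm i).1]
  · intro b _; rfl

/-- [our bookkeeping] `fineBlock n ⊆ box 4 n`. -/
theorem fineBlock_subset_box (n : ℕ) : fineBlock n ⊆ box 4 n := by
  intro m hm
  rw [mem_fineBlock] at hm
  exact mem_box.mpr fun i => ⟨by have := (hm i).1; omega, (hm i).2.le⟩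

/-- **THE SCALAR BLOCK AVERAGE AS A BLOCK SUM OVER THE SUP-BOX**:
`n⁻⁴·blockSum n f u = Σ_{m ∈ box 4 n} (n⁻⁴·𝟙_{fineBlock n} m)·f(n•u + m)`. [our bookkeeping] -/
theorem blockAvg_eq_boxSum (n : ℕ) (f : Pt → ℝ) (u : Pt) :
    ((n : ℝ) ^ 4)⁻¹ * blockSum n f u
      = ∑ m ∈ box 4 n, (if m ∈ fineBlock n then ((n : ℝ) ^ 4)⁻¹ else 0) * f (n • u + m) := by
  unfold blockSum
  rw [sum_affineBox_eq_sum_fineBlock n (fun m => f ((n : ℤ) • u + m)), mul_sum,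
    ← sum_subset (fineBlock_subset_box n) (fun m _ hm => by rw [if_neg hm, zero_mul])]
  refine sum_congr rfl fun m hm => ?_
  rw [if_pos hm, natCast_zsmul]

/-- [our bookkeeping] MASS LETTER of the flat block weight: `Σ_{m ∈ box n} |w m| ≤ 1` (`n ≥ 1`; in fact `= 1`). -/
theorem sum_box_abs_blockWeight_le {n : ℕ} (hn : 1 ≤ n) :
    ∑ m ∈ box 4 n, |(if m ∈ fineBlock n then ((n : ℝ) ^ 4)⁻¹ else 0)| ≤ 1 := by
  have hn' : (0 : ℝ) < (n : ℝ) ^ 4 := by positivity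
  rw [← sum_subset (fineBlock_subset_box n) (fun m _ hm => by rw [if_neg hm, abs_zero])]
  rw [sum_congr rfl fun m hm => by rw [if_pos hm, abs_of_nonneg (by positivity)], sum_const, card_fineBlock, nsmul_eq_mul]
  push_cast
  rw [mul_inv_cancel₀ hn'.ne']

/-- [our bookkeeping] FLATNESS LETTER: `|w m| ≤ n⁻⁴`. -/
theorem abs_blockWeight_le (n : ℕ) (m : Pt) (_hm : m ∈ box 4 n) :
    |(if m ∈ fineBlock n then ((n : ℝ) ^ 4)⁻¹ else 0)| ≤ 1 / (n : ℝ) ^ 4 := by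
  split_ifs
  · rw [abs_of_nonneg (by positivity), one_div]
  · rw [abs_zero]; positivity

/-- [our bookkeeping] FLATNESS × VOLUME: `n⁻⁴·(n+1)⁴ ≤ 16` (`n ≥ 1`). -/
theorem block_volume_le {n : ℕ} (hn : 1 ≤ n) : 1 / (n : ℝ) ^ 4 * ((n : ℝ) + 1) ^ 4 ≤ 16 := by
  have hn' : (1 : ℝ) ≤ n := by exact_mod_cast hn
  have hpos : (0 : ℝ) < (n : ℝ) ^ 4 := by positivity
  rw [div_mul_eq_mul_div, one_mul, div_le_iff₀ hpos]
  calc ((n : ℝ) + 1) ^ 4 ≤ (2 * (n : ℝ)) ^ 4 := pow_le_pow_left₀ (by positivity) (by linarith) 4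
    _ = 16 * (n : ℝ) ^ 4 := by ring

/-- [our bookkeeping] The PART-1 amplitude at the flat block letters: `3^b·(6561·n⁻⁴(n+1)⁴ + 1)·C ≤ 3^b·104977·C`. -/
theorem block_amplitude_le {n : ℕ} (hn : 1 ≤ n) (b : ℕ) {C : ℝ} (hC : 0 ≤ C) :
    3 ^ b * (6561 * (1 / (n : ℝ) ^ 4) * ((n : ℝ) + 1) ^ 4 + 1) * C ≤ 3 ^ b * 104977 * C := by
  have hv := block_volume_le hn
  have h' : 6561 * (1 / (n : ℝ) ^ 4) * ((n : ℝ) + 1) ^ 4 + 1 ≤ 104977 := by nlinarith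
  gcongr

/-! ## §2 The profiles of the scalar block average of a graded kernel -/

/-- **(i′) THE VALUE PROFILE.**  `|P z| ≤ C₀∕(‖z‖∞+1)^a`, `a ≤ 3`, `n ≥ 1` ⟹
`|n⁻⁴·blockSum n (y ↦ P(x − y)) u| ≤ 3^a·104977·C₀ ∕ (n + 1 + ‖x − n•u‖∞)^a`. [our bookkeeping] -/
theorem abs_blockAvg_le_profile {P : Pt → ℝ} {C₀ : ℝ} {a : ℕ} (ha : a ≤ 3)
    (hP : ∀ z, |P z| ≤ C₀ / ((supNorm z : ℝ) + 1) ^ a) {n : ℕ} (hn : 1 ≤ n) (x u : Pt) :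
    |((n : ℝ) ^ 4)⁻¹ * blockSum n (fun y => P (x - y)) u| ≤ 3 ^ a * 104977 * C₀ / ((n : ℝ) + 1 + supNorm (x - n • u)) ^ a := by
  have hC := letter_nonneg_of_le hP
  rw [blockAvg_eq_boxSum]
  have e : ∀ m ∈ box 4 n, (if m ∈ fineBlock n then ((n : ℝ) ^ 4)⁻¹ else 0) * P (x - (n • u + m))
      = (if m ∈ fineBlock n then ((n : ℝ) ^ 4)⁻¹ else 0) * P ((x - n • u) - m) := by
    intro m _; rw [sub_sub]
  rw [sum_congr rfl e]
  refine (abs_blockSum_le_profile ha hP (sum_box_abs_blockWeight_le hn) (abs_blockWeight_le n) (x - n • u)).trans ?_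
  exact div_le_div_of_nonneg_right (block_amplitude_le hn a hC) (by positivity)

/-- **(ii′) THE DIFFERENCE PROFILE** (one power better).  `|P(z + e_i) − P z| ≤ C₁∕(‖z‖∞+1)^{a+1}`, `a + 1 ≤ 3`, `n ≥ 1` ⟹
`|n⁻⁴·blockSum n (y ↦ P(x + e_i − y)) u − n⁻⁴·blockSum n (y ↦ P(x − y)) u| ≤ 3^{a+1}·104977·C₁ ∕ (n+1+‖x − n•u‖∞)^{a+1}`. [our bookkeeping] -/
theorem abs_blockAvg_fwdDiff_le_profile {P : Pt → ℝ} {C₁ : ℝ} {a : ℕ} (ha : a + 1 ≤ 3) (i : Fin 4)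
    (hΔ : ∀ z, |P (z + Pi.single i 1) - P z| ≤ C₁ / ((supNorm z : ℝ) + 1) ^ (a + 1)) {n : ℕ} (hn : 1 ≤ n) (x u : Pt) :
    |((n : ℝ) ^ 4)⁻¹ * blockSum n (fun y => P (x + Pi.single i 1 - y)) u - ((n : ℝ) ^ 4)⁻¹ * blockSum n (fun y => P (x - y)) u|
      ≤ 3 ^ (a + 1) * 104977 * C₁ / ((n : ℝ) + 1 + supNorm (x - n • u)) ^ (a + 1) := by
  have hC : 0 ≤ C₁ := letter_nonneg_of_le (K := fun z => P (z + Pi.single i 1) - P z) hΔ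
  rw [blockAvg_eq_boxSum, blockAvg_eq_boxSum]
  have e1 : ∀ m ∈ box 4 n, (if m ∈ fineBlock n then ((n : ℝ) ^ 4)⁻¹ else 0) * P (x + Pi.single i 1 - (n • u + m))
      = (if m ∈ fineBlock n then ((n : ℝ) ^ 4)⁻¹ else 0) * P ((x - n • u) + Pi.single i 1 - m) := by
    intro m _; congr 2; abel
  have e2 : ∀ m ∈ box 4 n, (if m ∈ fineBlock n then ((n : ℝ) ^ 4)⁻¹ else 0) * P (x - (n • u + m))
      = (if m ∈ fineBlock n then ((n : ℝ) ^ 4)⁻¹ else 0) * P ((x - n • u) - m) := by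
    intro m _; rw [sub_sub]
  rw [sum_congr rfl e1, sum_congr rfl e2]
  refine (abs_blockSum_fwdDiff_le_profile ha i hΔ (sum_box_abs_blockWeight_le hn) (abs_blockWeight_le n) (x - n • u)).trans ?_
  exact div_le_div_of_nonneg_right (block_amplitude_le hn (a + 1) hC) (by positivity)

/-- **(ii″) SECOND DIFFERENCES — THE MARGINAL DEGREE, ONE LOGARITHM.**  With the second-difference letter
`|P(z+e_μ+e_ν) − P(z+e_μ) − P(z+e_ν) + P z| ≤ C₂∕(‖z‖∞+1)⁴` (degree `4 = d`), the mixed second difference of the scalar block average obeys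
`≤ 81·(16·(97 + 64·log(3n)) + 1)·C₂ ∕ (n + 1 + ‖x − n•u‖∞)⁴` — PART 2 §9; the `log n` is genuine at block-edge-adjacent positions for `μ ≠ ν`
(the edge sum of a degree-2 kernel), so no log-free sup-norm version is offered. [our bookkeeping] -/
theorem abs_blockAvg_fwdDiff₂_le_profile_marginal {P : Pt → ℝ} {C₂ : ℝ} (μ ν : Fin 4)
    (hΔ₂ : ∀ z, |P (z + Pi.single μ 1 + Pi.single ν 1) - P (z + Pi.single μ 1) - P (z + Pi.single ν 1) + P z|
      ≤ C₂ / ((supNorm z : ℝ) + 1) ^ 4) {n : ℕ} (hn : 1 ≤ n) (x u : Pt) :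
    |((n : ℝ) ^ 4)⁻¹ * blockSum n (fun y => P (x + Pi.single μ 1 + Pi.single ν 1 - y)) u
        - ((n : ℝ) ^ 4)⁻¹ * blockSum n (fun y => P (x + Pi.single μ 1 - y)) u
        - ((n : ℝ) ^ 4)⁻¹ * blockSum n (fun y => P (x + Pi.single ν 1 - y)) u
        + ((n : ℝ) ^ 4)⁻¹ * blockSum n (fun y => P (x - y)) u|
      ≤ 81 * (16 * (97 + 64 * Real.log ((3 * n : ℕ) : ℝ)) + 1) * C₂ / ((n : ℝ) + 1 + supNorm (x - n • u)) ^ 4 := by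
  set K₂ : Pt → ℝ := fun z => P (z + Pi.single μ 1 + Pi.single ν 1) - P (z + Pi.single μ 1) - P (z + Pi.single ν 1) + P z
    with hK₂
  have hC : 0 ≤ C₂ := letter_nonneg_of_le (K := K₂) hΔ₂
  set w : Pt → ℝ := fun m => if m ∈ fineBlock n then ((n : ℝ) ^ 4)⁻¹ else 0 with hw
  have e : ((n : ℝ) ^ 4)⁻¹ * blockSum n (fun y => P (x + Pi.single μ 1 + Pi.single ν 1 - y)) u
        - ((n : ℝ) ^ 4)⁻¹ * blockSum n (fun y => P (x + Pi.single μ 1 - y)) u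
        - ((n : ℝ) ^ 4)⁻¹ * blockSum n (fun y => P (x + Pi.single ν 1 - y)) u
        + ((n : ℝ) ^ 4)⁻¹ * blockSum n (fun y => P (x - y)) u
      = ∑ m ∈ box 4 n, w m * K₂ ((x - n • u) - m) := by
    simp only [blockAvg_eq_boxSum, hw, hK₂, ← sum_sub_distrib, ← sum_add_distrib]
    refine sum_congr rfl fun m _ => ?_
    rw [show x + Pi.single μ 1 + Pi.single ν 1 - (n • u + m) = x - n • u - m + Pi.single μ 1 + Pi.single ν 1 by abel,
      show x + Pi.single μ 1 - (n • u + m) = x - n • u - m + Pi.single μ 1 by abel,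
      show x + Pi.single ν 1 - (n • u + m) = x - n • u - m + Pi.single ν 1 by abel,
      show x - (n • u + m) = x - n • u - m by abel]
    ring
  rw [e]
  refine (abs_blockSum_le_profile_marginal hΔ₂ (sum_box_abs_blockWeight_le hn) (abs_blockWeight_le n) (x - n • u)).trans ?_
  refine div_le_div_of_nonneg_right ?_ (by positivity)
  have hlog : 0 ≤ 97 + 64 * Real.log ((3 * n : ℕ) : ℝ) := by
    have := Real.log_natCast_nonneg (3 * n); linarith
  have hv := block_volume_le hn
  have : 1 / (n : ℝ) ^ 4 * ((n : ℝ) + 1) ^ 4 * (97 + 64 * Real.log ((3 * n : ℕ) : ℝ))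
      ≤ 16 * (97 + 64 * Real.log ((3 * n : ℕ) : ℝ)) := mul_le_mul_of_nonneg_right hv hlog
  gcongr

/-- [our bookkeeping] The plain double block average as a double block sum over the sup-boxes against the flat weights. -/
theorem blockAvg₂_eq_doubleBoxSum (n : ℕ) (P : Pt → ℝ) (u v : Pt) :
    ((n : ℝ) ^ 4)⁻¹ * blockSum n (fun y => ((n : ℝ) ^ 4)⁻¹ * blockSum n (fun y' => P (y - y')) v) u
      = ∑ m ∈ box 4 n, ∑ m' ∈ box 4 n, (if m ∈ fineBlock n then ((n : ℝ) ^ 4)⁻¹ else 0)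
          * (if m' ∈ fineBlock n then ((n : ℝ) ^ 4)⁻¹ else 0) * P (n • u + m - (n • v + m')) := by
  rw [blockAvg_eq_boxSum]
  refine sum_congr rfl fun m _ => ?_
  rw [blockAvg_eq_boxSum, mul_sum]
  refine sum_congr rfl fun m' _ => ?_
  ring

/-- **(iii′) THE DOUBLE BLOCK AVERAGE PROFILE.**  `|P z| ≤ C₀∕(‖z‖∞+1)^a`, `a ≤ 3`, `n ≥ 1` ⟹
`|n⁻⁴·blockSum n (y ↦ n⁻⁴·blockSum n (y′ ↦ P(y − y′)) v) u| ≤ (3^a·104977)·((3^a·104977)·C₀) ∕ (n + 1 + ‖n•u − n•v‖∞)^a`. [our bookkeeping] -/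
theorem abs_blockAvg₂_le_profile {P : Pt → ℝ} {C₀ : ℝ} {a : ℕ} (ha : a ≤ 3)
    (hP : ∀ z, |P z| ≤ C₀ / ((supNorm z : ℝ) + 1) ^ a) {n : ℕ} (hn : 1 ≤ n) (u v : Pt) :
    |((n : ℝ) ^ 4)⁻¹ * blockSum n (fun y => ((n : ℝ) ^ 4)⁻¹ * blockSum n (fun y' => P (y - y')) v) u|
      ≤ (3 ^ a * 104977) * (3 ^ a * 104977 * C₀) / ((n : ℝ) + 1 + supNorm (n • u - n • v)) ^ a := by
  have hC := letter_nonneg_of_le hP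
  rw [blockAvg₂_eq_doubleBoxSum]
  refine (abs_doubleBlockSum_le_profile ha hP (sum_box_abs_blockWeight_le hn) (abs_blockWeight_le n)
    (sum_box_abs_blockWeight_le hn) (abs_blockWeight_le n) (n • u) (n • v)).trans ?_
  refine div_le_div_of_nonneg_right ?_ (by positivity)
  have h1 := block_amplitude_le hn a hC
  have h2 := block_amplitude_le hn a (C := 3 ^ a * 104977 * C₀) (by positivity)
  have h0 : 0 ≤ 3 ^ a * (6561 * (1 / (n : ℝ) ^ 4) * ((n : ℝ) + 1) ^ 4 + 1) := by positivity
  calc 3 ^ a * (6561 * (1 / (n : ℝ) ^ 4) * ((n : ℝ) + 1) ^ 4 + 1)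
        * (3 ^ a * (6561 * (1 / (n : ℝ) ^ 4) * ((n : ℝ) + 1) ^ 4 + 1) * C₀)
      ≤ 3 ^ a * (6561 * (1 / (n : ℝ) ^ 4) * ((n : ℝ) + 1) ^ 4 + 1) * (3 ^ a * 104977 * C₀) :=
        mul_le_mul_of_nonneg_left h1 h0
    _ ≤ 3 ^ a * 104977 * (3 ^ a * 104977 * C₀) := h2

/-- **(iii′) IN COARSE DISTANCE**: `≤ (3^a·104977)²·C₀ ∕ (n^a·(1 + ‖u − v‖∞)^a)` — at `a = 2` the `C₂ n⁻²(1 + |u − v|∞)⁻²` of the row for the plain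
`n⁻⁸ΣΣ` double block average. [our bookkeeping] -/
theorem abs_blockAvg₂_le_coarse {P : Pt → ℝ} {C₀ : ℝ} {a : ℕ} (ha : a ≤ 3)
    (hP : ∀ z, |P z| ≤ C₀ / ((supNorm z : ℝ) + 1) ^ a) {n : ℕ} (hn : 1 ≤ n) (u v : Pt) :
    |((n : ℝ) ^ 4)⁻¹ * blockSum n (fun y => ((n : ℝ) ^ 4)⁻¹ * blockSum n (fun y' => P (y - y')) v) u|
      ≤ (3 ^ a * 104977) ^ 2 * C₀ / ((n : ℝ) ^ a * (1 + (supNorm (u - v) : ℝ)) ^ a) := by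
  have hC := letter_nonneg_of_le hP
  have hn' : (1 : ℝ) ≤ n := by exact_mod_cast hn
  refine (abs_blockAvg₂_le_profile ha hP hn u v).trans ?_
  have hsm : (supNorm (n • u - n • v) : ℝ) = n * supNorm (u - v) := by
    rw [← smul_sub, supNorm_nsmul_real]
  rw [hsm, ← mul_pow, show (3 ^ a * 104977) * (3 ^ a * 104977 * C₀) = ((3 : ℝ) ^ a * 104977) ^ 2 * C₀ by ring]
  refine div_le_div_of_nonneg_left (by positivity) (by positivity) (pow_le_pow_left₀ (by positivity) ?_ a)
  have h0 : (0 : ℝ) ≤ supNorm (u - v) := Nat.cast_nonneg _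
  nlinarith

end Summit.QuantumFields.BalabanUV.Beta.FP.BlockAveragedKernelScalar

end
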